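import Literature.NumberTheory.Transcendental.KZCubicalCalculus
import Literature.NumberTheory.Transcendental.BakerLogarithmsConclusion

/-!
# `ReductionRigidity` (stmt-KontsevichZagierPeriods-3407), line `Sketch` (Padé box island, `w = 2`):
# stub `stub_lineRigidity`

THE RIGIDITY OF THE WEIGHT-ONE ISLAND. On the box sector
`S_N = {[□², x^a y^b/(N − xy)^m], [□¹, x^c/(N − x)^m], [pt, q]}` (`□ = [0, 1]`, `N ≥ 2`) the lead's
`lineReduction` (over `stub_lineBase`, `stub_lineDescent`) brings every generator of the weight-one
sub-island `{[□¹, x^c/(N − x)^m], [pt, q]}` inside `KZ.relations` to the two normal forms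
`[□¹, β/(N − x)] + [pt, γ]` (`β, γ ∈ ℚ`), so the kernel form of Conjecture 1 on that island is exactly
the `ℚ`-linear independence of the two normal-form VALUES `1` and `L₁ = ∫_□ dx/(N − x)`. This file
proves it (`stub_lineRigidity`), which makes the weight-one island theorem `padeBoxKernelOne`
unconditional.

* VALUE (`integral_cube_one_one_div_sub`): `L₁ = log (N/(N − 1))`: the set integral over
  `KZ.cube 1 ⊆ (Fin 1 → ℝ)` is transported to `[0, 1] ⊆ ℝ` along the measure-preserving evaluation
  `MeasurableEquiv.funUnique (Fin 1) ℝ`, then the substitution `u = N − x` and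
  `∫_{N−1}^{N} du/u = log (N/(N − 1))` (`integral_one_div_of_pos`).
* INDEPENDENCE (`eq_zero_of_add_mul_log_eq_zero`): `r = N/(N − 1)` is a rational number `> 0`, `≠ 1`,
  so `log r ≠ 0` is a logarithm of the algebraic number `e^{log r} = r`; by BAKER'S THEOREM with one
  logarithm — the tree's PROVED `Literature.NumberTheory.Transcendental.baker_holds` (Baker 1975,
  Theorem 2.1) — `1, log r` are linearly independent over the field `ℚ̄` of all algebraic numbers, a
  fortiori over `ℚ`.
-/

noncomputable section

open MeasureTheory Set MvPolynomial

namespace Summit.KontsevichZagierPeriods.HermiteRigidity.ReductionRigidity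

open Literature.NumberTheory.Transcendental
open Literature.NumberTheory.Transcendental.KZ

/-! ## The value `L₁ = ∫_□ dx/(N − x) = log (N/(N − 1))` -/

/-- Transport of a set integral over the one-dimensional closed unit cube to the unit interval:
the cube of `Fin 1 → ℝ` is the preimage of `[0, 1]` under the evaluation `(Fin 1 → ℝ) ≃ᵐ ℝ` at the
unique coordinate, which preserves Lebesgue measure. [folklore] -/
theorem setIntegral_cube_one_eq (g : ℝ → ℝ) :
    ∫ p in cube 1, g (p 0) = ∫ x in Icc (0 : ℝ) 1, g x := by
  have hcube : cube 1 = (MeasurableEquiv.funUnique (Fin 1) ℝ) ⁻¹' Icc (0 : ℝ) 1 := by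
    ext t
    rw [mem_cube, Fin.forall_fin_one, Set.mem_preimage, Set.mem_Icc]
    exact Iff.rfl
  rw [hcube]
  exact (volume_preserving_funUnique (Fin 1) ℝ).setIntegral_preimage_emb
    (MeasurableEquiv.measurableEmbedding _) g (Icc (0 : ℝ) 1)

/-- `∫₀¹ dx/(N − x) = log (N/(N − 1))` for `N ≥ 2` (substitution `u = N − x`, then `∫ du/u = log`).
[folklore] -/
theorem intervalIntegral_one_div_sub {N : ℕ} (hN : 2 ≤ N) :
    ∫ x in (0 : ℝ)..1, 1 / ((N : ℝ) - x) = Real.log ((N : ℝ) / ((N : ℝ) - 1)) := by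
  have h2 : (2 : ℝ) ≤ (N : ℝ) := by exact_mod_cast hN
  have h := intervalIntegral.integral_comp_sub_left (a := 0) (b := 1) (fun x : ℝ => 1 / x) (N : ℝ)
  simp only [sub_zero] at h
  rw [h]
  exact integral_one_div_of_pos (by linarith) (by linarith)

/-- **The value of the weight-one normal form**: `L₁ = ∫_□ dx/(N − x) = log (N/(N − 1))` for
`N ≥ 2` (fundamental theorem of calculus on `[0, 1]`, after transporting the cube of `Fin 1 → ℝ` to
the interval). [folklore] -/
theorem integral_cube_one_one_div_sub {N : ℕ} (hN : 2 ≤ N) :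
    ∫ p in cube 1, 1 / ((N : ℝ) - p 0) = Real.log ((N : ℝ) / ((N : ℝ) - 1)) := by
  have h := setIntegral_cube_one_eq (fun x => 1 / ((N : ℝ) - x))
  rw [h, integral_Icc_eq_integral_Ioc, ← intervalIntegral.integral_of_le zero_le_one]
  exact intervalIntegral_one_div_sub hN

/-! ## The independence of `1` and `log r` (Baker's theorem with one logarithm) -/

section Baker

open Complex

/-- **`1` and `log r` are `ℚ`-linearly independent** for a rational `r > 0`, `r ≠ 1`: if
`a + b·log r = 0` with `a, b ∈ ℚ` then `a = b = 0`. By BAKER'S THEOREM (the tree's proved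
`baker_holds`, with the single logarithm `l = log r`: `e^{l} = r` is algebraic and `l ≠ 0`, so `l` is
`ℚ`-linearly independent), `1, log r` are linearly independent over the field of all algebraic
numbers, in particular over `ℚ`. [cite: Baker1975, Theorem 2.1] -/
theorem eq_zero_of_add_mul_log_eq_zero {r : ℚ} (hr : 0 < r) (hr1 : r ≠ 1) {a b : ℚ}
    (h : (a : ℝ) + b * Real.log r = 0) : a = 0 ∧ b = 0 := by
  -- the single logarithm, in `ℂ`
  set l : Fin 1 → ℂ := fun _ => ((Real.log r : ℝ) : ℂ) with hl
  have hlog0 : Real.log r ≠ 0 :=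
    Real.log_ne_zero_of_pos_of_ne_one (by exact_mod_cast hr) (by exact_mod_cast hr1)
  have hexp : cexp ((Real.log r : ℝ) : ℂ) = (r : ℂ) := by
    rw [← Complex.ofReal_exp, Real.exp_log (by exact_mod_cast hr), Complex.ofReal_ratCast]
  have halg : ∀ i, IsAlgebraic ℚ (cexp (l i)) := by
    intro i
    rw [hl, hexp]
    simpa using isAlgebraic_algebraMap (R := ℚ) (A := ℂ) r
  have hli : LinearIndependent ℚ l := by
    rw [linearIndependent_unique_iff]
    exact Complex.ofReal_ne_zero.mpr hlog0
  -- Baker: `1, l` are linearly independent over `ℚ̄ = algebraicClosure ℚ ℂ`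
  have hB := baker_holds l halg hli
  rw [Fintype.linearIndependent_iff] at hB
  -- the given relation, with its rational coefficients viewed as algebraic numbers
  have hC : (a : ℂ) + (b : ℂ) * ((Real.log r : ℝ) : ℂ) = 0 := by
    exact_mod_cast congrArg (fun x : ℝ => (x : ℂ)) h
  have hg := hB (fun o => o.elim (a : algebraicClosure ℚ ℂ) fun _ => (b : algebraicClosure ℚ ℂ))
    (by
      rw [Fintype.sum_option, Fin.sum_univ_one]
      simp only [Option.elim_none, Option.elim_some, IntermediateField.smul_def, smul_eq_mul,
        SubfieldClass.coe_ratCast, mul_one]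
      exact hC)
  have ha := hg none
  have hb := hg (some 0)
  simp only [Option.elim_none, Option.elim_some, Rat.cast_eq_zero] at ha hb
  exact ⟨ha, hb⟩

end Baker

/-! ## The stub -/

/-- STUB `lineRigidity` (v6) of line `Sketch` (crux `ReductionRigidity`, stmt-KontsevichZagierPeriods-3407):
the two normal-form values of the LINE sector, `1` and `L₁ = ∫_□ dx/(N − x)`, are linearly
independent over `ℚ` for every `N ≥ 2`. Proof: `L₁ = log (N/(N − 1))` by the fundamental theorem of
calculus (`integral_cube_one_one_div_sub`), and `1, log (N/(N − 1))` are `ℚ`-linearly independent by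
Baker's theorem with one logarithm (`eq_zero_of_add_mul_log_eq_zero`, from the tree's proved
`baker_holds`; `N/(N − 1)` is a rational number `> 0` and `≠ 1`). [cite: Baker1975, Theorem 2.1] -/
theorem stub_lineRigidity : ∀ (N : ℕ), 2 ≤ N → ∀ a b : ℚ,
    (a : ℝ) + b * (∫ p in cube 1, 1 / ((N : ℝ) - p 0)) = 0 → a = 0 ∧ b = 0 := by
  intro N hN a b h
  rw [integral_cube_one_one_div_sub hN] at h
  have h2 : (2 : ℚ) ≤ (N : ℚ) := by exact_mod_cast hN
  have hr : (0 : ℚ) < (N : ℚ) / ((N : ℚ) - 1) := div_pos (by linarith) (by linarith)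
  have hr1 : (N : ℚ) / ((N : ℚ) - 1) ≠ 1 := by
    rw [Ne, div_eq_one_iff_eq (by linarith)]
    linarith
  refine eq_zero_of_add_mul_log_eq_zero hr hr1 (a := a) (b := b) ?_
  have hcast : (((N : ℚ) / ((N : ℚ) - 1) : ℚ) : ℝ) = (N : ℝ) / ((N : ℝ) - 1) := by push_cast; ring
  rw [hcast]
  exact h

end Summit.KontsevichZagierPeriods.HermiteRigidity.ReductionRigidity
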